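import Summits.Ventures.LatticeQCDFlow.Scaling.SimulatedTemperingFiniteCeiling
import Summits.Ventures.LatticeQCDFlow.Scaling.CouplingOverlap

/-!
HONEST FRAMING: exact (Metropolis-corrected) sampling algorithms for lattice gauge theory; figures
of merit are autocorrelation/cost numbers at stated couplings and volumes; no continuum-physics
claim.

# SimulatedTemperingFiniteWindowLaw — THE EXPLICIT CEILING IN THE COUPLING WINDOW AND THE VARIANCE CEILING:
# tempering in the coupling `β ∈ [a,b]` of a finite system with `Var_β(X) ≤ M`, on the uniform ladder with
# `K ≥ (b−a)√M` gaps, has `τ_int(g) ≤ 8e²(K+1)²/min{1,γ_M} − ½` FOR EVERY OBSERVABLE `g` — `O((b−a)²M/γ_M)`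
# at `K ≈ (b−a)√M`, against the GEN-13 floor `e·m·(b−a)²/96 − ½` (lean-2 GEN-16, ours)

Venture-side (OURS).  Cell `lqcd-flow` (pub-lqcd), unit `pub-lqcd-lean-2-g16`, 2026-08-24.  The levels of
chapter X were abstract probability vectors with adjacent overlaps `≥ a`.  Here they are what tempering in the
coupling uses: the exponential family `μ_β(x) = w(x)e^{βX(x)}/Z(β)` of a base weight `w > 0` and an action `X`
on the finite configuration space `S` (`stFinTilt`), at the uniform ladder `β_k = a + kΔ`, `Δ = (b−a)/K`.  The
finite configuration space is read as the discrete probability space `(S, μ_w)` (`finLawMeasure w` = counting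
measure with density `w`; `integral_finLawMeasure`: `∫ g dμ_w = Σ_x w(x)g(x)`), so that GEN-11's OVERLAP LAW
(`Scaling/CouplingOverlap.overlap_ge_exp_neg_ceiling`: `∫ min(p_s,p_t) dμ ≥ exp(−((t−s)√M + M(t−s)²))` under a
variance ceiling `M` on `[s,t]`) applies verbatim: `stFinOverlap_tilt_eq_integral`.

* §1 `finLawMeasure`, `integral_finLawMeasure`, `isProbabilityMeasure_finLawMeasure`; `stFinTilt`,
  `stFinTilt_pos`, `sum_stFinTilt`, `integral_tilted_finLawMeasure`, **`variance_tilted_finLawMeasure`** (the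
  variance ceiling in finite terms: `Var_{μ_w tilted}(X) = lawVariance (μ_u) X`), **`stFinOverlap_tilt_eq_integral`**.
* §2 **`stFinOverlap_ladder_ge`** — on the uniform ladder with `K ≥ (b−a)√M` (`K ≥ 1`) every adjacent overlap
  is `≥ e^{−2}`; **`stFinWindow_tauInt_le`** — hence, for the half-half simulated-tempering sampler with ANY
  exact reversible irreducible within-level updates of Poincaré constant `γ_M`:
  **`τ_int(g) ≤ 8e²(K+1)²/min{1,γ_M} − ½` for every non-constant observable `g`** (`stFinWindow_tauInt_le'`:
  the same with the hypothesis `lawVariance (μ_u) X ≤ M_v` in finite terms); with the floor of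
  `Scaling/SimulatedTemperingFiniteFloor` (`(K+1)(K+2)/3 − ½ ≤ τ_int(level)`) and GEN-13's window floor
  `e·m·(b−a)²/96 − ½` (variance FLOOR `m`, kernel level) the law is TWO-SIDED in `(b−a)²·Var(X)` up to `M/m`,
  the factor `1/γ_M` and absolute constants.  For an extensive action (`Var_β(X) ∝ volume`) this is the
  volume law of tempering in the coupling: `Θ((b−a)²·volume)` sampler sweeps, times the within-level relaxation.

NOT CLAIMED: general configuration spaces; the choice of `γ_M` for any concrete update; that `1/γ_M` is
attained; anything measured.  Literature grade (cell rule): KNOWN MECHANISM (exponential-family overlap /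
Bhattacharyya; decomposition bounds) with explicit constants, NEW TYPING; nothing cited as a fact; no new bib keys.
-/

noncomputable section

open Finset MeasureTheory ProbabilityTheory Real Set
open Literature.Probability.MarkovChains
open scoped ENNReal NNReal

namespace Summit.Ventures.LatticeQCDFlow.Scaling

variable {S : Type*} [Fintype S] [MeasurableSpace S] [MeasurableSingletonClass S]

/-! ## §1 The finite configuration space as a discrete probability space; the tilted levels -/

/-- The law `w` on the finite configuration space as a measure: counting measure with density `w`. [ours] -/
def finLawMeasure (w : S → ℝ) : Measure S :=
  (Measure.count : Measure S).withDensity fun x => ((w x).toNNReal : ℝ≥0∞)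

/-- **Integrals against `finLawMeasure w` are the finite sums `Σ_x w(x)g(x)`** (`w ≥ 0`). [ours] -/
theorem integral_finLawMeasure {w : S → ℝ} (hw0 : ∀ x, 0 ≤ w x) (g : S → ℝ) :
    ∫ x, g x ∂(finLawMeasure w) = ∑ x, w x * g x := by
  unfold finLawMeasure
  rw [integral_withDensity_eq_integral_smul (measurable_of_countable _), integral_fintype (Integrable.of_finite)]
  refine sum_congr rfl fun x _ => ?_
  rw [measureReal_def, Measure.count_singleton, ENNReal.toReal_one, one_smul, NNReal.smul_def, smul_eq_mul,
    Real.coe_toNNReal _ (hw0 x)]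

/-- `finLawMeasure w` is a probability measure when `w ≥ 0` sums to `1`. [ours] -/
theorem isProbabilityMeasure_finLawMeasure {w : S → ℝ} (hw0 : ∀ x, 0 ≤ w x) (hw1 : ∑ x, w x = 1) :
    IsProbabilityMeasure (finLawMeasure w) := by
  constructor
  unfold finLawMeasure
  rw [withDensity_apply _ MeasurableSet.univ, Measure.restrict_univ, lintegral_fintype]
  simp_rw [Measure.count_singleton, mul_one]
  rw [← ENNReal.ofNNReal_finsetSum, ← Real.toNNReal_sum_of_nonneg (fun x _ => hw0 x), hw1, Real.toNNReal_one,
    ENNReal.coe_one]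

/-- The tilted level law at coupling `u`: `μ_u(x) = w(x)·e^{uX(x)}/Z(u)`, `Z(u) = Σ_x w(x)e^{uX(x)}` (the moment
generating function of `X` under `μ_w`). [ours] -/
def stFinTilt (w X : S → ℝ) (u : ℝ) (x : S) : ℝ := w x * (exp (u * X x) / mgf X (finLawMeasure w) u)

/-- `Z(u) = Σ_x w(x)e^{uX(x)} > 0` for a positive base weight. [ours] -/
theorem mgf_finLawMeasure_eq {w : S → ℝ} (hw0 : ∀ x, 0 ≤ w x) (X : S → ℝ) (u : ℝ) :
    mgf X (finLawMeasure w) u = ∑ x, w x * exp (u * X x) := by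
  unfold mgf
  exact integral_finLawMeasure hw0 _

/-- The tilted levels are positive. [ours] -/
theorem stFinTilt_pos [Nonempty S] {w : S → ℝ} (hw : ∀ x, 0 < w x) (X : S → ℝ) (u : ℝ) (x : S) :
    0 < stFinTilt w X u x := by
  unfold stFinTilt
  have hZ : 0 < mgf X (finLawMeasure w) u := by
    rw [mgf_finLawMeasure_eq (fun x => (hw x).le)]
    exact Finset.sum_pos (fun y _ => mul_pos (hw y) (exp_pos _)) Finset.univ_nonempty
  exact mul_pos (hw x) (div_pos (exp_pos _) hZ)

/-- The tilted levels are probability vectors. [ours] -/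
theorem sum_stFinTilt {w : S → ℝ} (hw : ∀ x, 0 < w x) (hw1 : ∑ x, w x = 1) (X : S → ℝ) (u : ℝ) :
    ∑ x, stFinTilt w X u x = 1 := by
  haveI := isProbabilityMeasure_finLawMeasure (fun x => (hw x).le) hw1
  unfold stFinTilt
  rw [← integral_finLawMeasure (fun x => (hw x).le)]
  exact integral_tiltedDensity_eq_one (μ := finLawMeasure w) (measurable_of_countable X)
    ⟨∑ y, |X y|, fun x => Finset.single_le_sum (fun y _ => abs_nonneg (X y)) (Finset.mem_univ x)⟩ u


/-- **Integrals against the tilted measure are the finite sums against the tilted level law:**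
`∫ g d(μ_w tilted by uX) = Σ_x μ_u(x)·g(x)`. [ours] -/
theorem integral_tilted_finLawMeasure {w : S → ℝ} (hw0 : ∀ x, 0 ≤ w x) (X : S → ℝ) (u : ℝ) (g : S → ℝ) :
    ∫ x, g x ∂((finLawMeasure w).tilted fun x => u * X x) = ∑ x, stFinTilt w X u x * g x := by
  rw [integral_tilted, integral_finLawMeasure hw0]
  unfold stFinTilt mgf
  exact sum_congr rfl fun x _ => by rw [smul_eq_mul]; ring

/-- **The variance ceiling in finite terms:** `Var_{μ_w tilted by uX}(X) = lawVariance (μ_u) X`, the variance of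
the action under the tilted level law. [ours] -/
theorem variance_tilted_finLawMeasure {w : S → ℝ} (hw0 : ∀ x, 0 ≤ w x) (X : S → ℝ) (u : ℝ) :
    variance X ((finLawMeasure w).tilted fun x => u * X x) = lawVariance (stFinTilt w X u) X := by
  rw [variance_eq_integral (measurable_of_countable X).aemeasurable, integral_tilted_finLawMeasure hw0,
    integral_tilted_finLawMeasure hw0]
  rfl

/-- **The overlap of two tilted levels is GEN-11's overlap integral:**
`stFinOverlap (μ_{β_·}) i j = ∫ min(p_{β_i}, p_{β_j}) dμ_w`. [ours] -/
theorem stFinOverlap_tilt_eq_integral [DecidableEq S] {K : ℕ} {w : S → ℝ} (hw0 : ∀ x, 0 ≤ w x) (X : S → ℝ)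
    (β : Fin (K + 1) → ℝ) (i j : Fin (K + 1)) :
    stFinOverlap (fun k => stFinTilt w X (β k)) i j
      = ∫ x, min (exp (β i * X x) / mgf X (finLawMeasure w) (β i))
          (exp (β j * X x) / mgf X (finLawMeasure w) (β j)) ∂(finLawMeasure w) := by
  rw [integral_finLawMeasure hw0]
  unfold stFinOverlap stFinTilt
  exact sum_congr rfl fun x _ => (mul_min_of_nonneg _ _ (hw0 x)).symm

/-! ## §2 The uniform ladder with `K ≥ (b−a)√M` gaps: overlaps `≥ e^{−2}`, and the window law -/

section Window

variable [DecidableEq S] {K : ℕ} {w X : S → ℝ} {M : Fin (K + 1) → Matrix S S ℝ} {a b Mv : ℝ}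

/-- **On the uniform ladder `β_k = a + k(b−a)/K` with `K ≥ (b−a)√M_v` (`K ≥ 1`, variance ceiling
`Var_{μ_u}(X) ≤ M_v` on `[a,b]`), every pair of adjacent tilted levels overlaps at least `e^{−2}`.** [ours] -/
theorem stFinOverlap_ladder_ge [Nonempty S] (hw : ∀ x, 0 < w x) (hw1 : ∑ x, w x = 1) (hK : 1 ≤ K)
    (hab : a ≤ b) (hMv : 0 ≤ Mv)
    (hvar : ∀ u ∈ Icc a b, variance X ((finLawMeasure w).tilted fun x => u * X x) ≤ Mv)
    (hKM : (b - a) * sqrt Mv ≤ K) (i j : Fin (K + 1)) (hij : j.val = i.val + 1 ∨ i.val = j.val + 1) :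
    exp (-2) ≤ stFinOverlap (fun k : Fin (K + 1) => stFinTilt w X (a + k * ((b - a) / K))) i j := by
  haveI := isProbabilityMeasure_finLawMeasure (fun x => (hw x).le) hw1
  have hXm : Measurable X := measurable_of_countable X
  have hXb : ∃ C, ∀ x, |X x| ≤ C :=
    ⟨∑ y, |X y|, fun x => Finset.single_le_sum (fun y _ => abs_nonneg (X y)) (Finset.mem_univ x)⟩
  have hKr : (1 : ℝ) ≤ K := by exact_mod_cast hK
  have hKpos : (0 : ℝ) < K := by linarith
  set Δ := (b - a) / K with hΔ
  have hΔ0 : 0 ≤ Δ := div_nonneg (sub_nonneg.2 hab) hKpos.le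
  -- the gap times √M is at most one, and so is M·Δ²
  have hΔM : Δ * sqrt Mv ≤ 1 := by
    rw [hΔ, div_mul_eq_mul_div, div_le_one hKpos]
    exact hKM
  have hΔM2 : Mv * Δ ^ 2 ≤ 1 := by
    have h1 : Mv * Δ ^ 2 = (Δ * sqrt Mv) ^ 2 := by
      rw [mul_pow, sq_sqrt hMv]; ring
    rw [h1]
    have h0 : 0 ≤ Δ * sqrt Mv := mul_nonneg hΔ0 (sqrt_nonneg _)
    nlinarith
  -- reduce to the case `j = i + 1` by symmetry of the overlap
  wlog h : j.val = i.val + 1 generalizing i j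
  · rw [stFinOverlap_comm]
    exact this j i (Or.symm hij) (hij.resolve_left h)
  -- the two couplings `s = β_i ≤ t = β_j = s + Δ` lie in `[a,b]`
  set s := a + (i : ℝ) * Δ with hs
  set t := a + (j : ℝ) * Δ with ht
  have hjK : (j : ℝ) ≤ K := by
    have := j.2; exact_mod_cast (by omega : (j : ℕ) ≤ K)
  have hts : t - s = Δ := by rw [ht, hs, h]; push_cast; ring
  have hst : s ≤ t := by linarith
  have hsa : a ≤ s := by rw [hs]; nlinarith [(Nat.cast_nonneg (i : ℕ) : (0 : ℝ) ≤ i)]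
  have htb : t ≤ b := by
    rw [ht, hΔ]
    have : (j : ℝ) * ((b - a) / K) ≤ K * ((b - a) / K) :=
      mul_le_mul_of_nonneg_right hjK (div_nonneg (sub_nonneg.2 hab) hKpos.le)
    rw [mul_div_cancel₀ _ hKpos.ne'] at this
    linarith
  have hvar' : ∀ u ∈ Icc s t, variance X ((finLawMeasure w).tilted fun x => u * X x) ≤ Mv :=
    fun u hu => hvar u ⟨hsa.trans hu.1, hu.2.trans htb⟩
  have key := overlap_ge_exp_neg_ceiling (μ := finLawMeasure w) hXm hXb hst hvar'
  rw [stFinOverlap_tilt_eq_integral (fun x => (hw x).le)]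
  refine le_trans ?_ key
  rw [exp_le_exp, hts, neg_le_neg_iff]
  nlinarith [hΔM, hΔM2]

/-- **THE WINDOW LAW (half-half simulated tempering in the coupling, finite configuration space).**  Base weight
`w > 0`, action `X`, variance ceiling `Var_{μ_u}(X) ≤ M_v` for `u ∈ [a,b]`, uniform ladder `β_k = a + k(b−a)/K`
with `K ≥ (b−a)√M_v` (`K ≥ 1`), ANY exact reversible irreducible within-level updates with Poincaré constant
`γ_M > 0`: for every non-constant observable `g` of (level, configuration),
**`τ_int(g) := asympVar/(2Var) ≤ 8e²(K+1)²/min{1,γ_M} − ½`** — `O((b−a)²M_v/γ_M)` at `K ≈ (b−a)√M_v`. [ours] -/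
theorem stFinWindow_tauInt_le [Nonempty S] (hw : ∀ x, 0 < w x) (hw1 : ∑ x, w x = 1) (hK : 1 ≤ K)
    (hab : a ≤ b) (hMv : 0 ≤ Mv)
    (hvar : ∀ u ∈ Icc a b, variance X ((finLawMeasure w).tilted fun x => u * X x) ≤ Mv)
    (hKM : (b - a) * sqrt Mv ≤ K)
    (hM : ∀ k, IsRowStochastic (M k))
    (hMrev : ∀ k : Fin (K + 1), DetailedBalance (stFinTilt w X (a + k * ((b - a) / K))) (M k))
    (hMirr : ∀ k, IsIrreducible (M k)) {γ : ℝ} (hγ : 0 < γ)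
    (hgap : ∀ k : Fin (K + 1), ∀ h : S → ℝ,
      γ * lawVariance (stFinTilt w X (a + k * ((b - a) / K))) h
        ≤ dirichletForm (stFinTilt w X (a + k * ((b - a) / K))) (M k) h)
    {g : Fin (K + 1) × S → ℝ}
    (hg : 0 < lawVariance (stFinLaw fun k : Fin (K + 1) => stFinTilt w X (a + k * ((b - a) / K))) g) :
    asympVar g (stFinLaw fun k : Fin (K + 1) => stFinTilt w X (a + k * ((b - a) / K)))
        (stFinSampler (1 / 2) (fun k : Fin (K + 1) => stFinTilt w X (a + k * ((b - a) / K))) M)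
        / (2 * lawVariance (stFinLaw fun k : Fin (K + 1) => stFinTilt w X (a + k * ((b - a) / K))) g)
      ≤ 8 * exp 2 * (K + 1) ^ 2 / min 1 γ - 1 / 2 := by
  have hov := stFinOverlap_ladder_ge (X := X) hw hw1 hK hab hMv hvar hKM
  have h := stFinHalf_tauInt_le (μ := fun k : Fin (K + 1) => stFinTilt w X (a + k * ((b - a) / K)))
    hK (fun k x => stFinTilt_pos hw X _ x) (fun k => sum_stFinTilt hw hw1 X _) hM hMrev hMirr (exp_pos (-2)) hγ
    hov hgap hg
  have e : 8 * ((K : ℝ) + 1) ^ 2 / (exp (-2) * min 1 γ) = 8 * exp 2 * (K + 1) ^ 2 / min 1 γ := by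
    rw [Real.exp_neg]
    have : exp 2 ≠ 0 := (exp_pos 2).ne'
    field_simp
  rwa [e] at h

/-- **THE WINDOW LAW with the variance ceiling in finite terms** (`lawVariance (μ_u) X ≤ M_v` for `u ∈ [a,b]`).
[ours] -/
theorem stFinWindow_tauInt_le' [Nonempty S] (hw : ∀ x, 0 < w x) (hw1 : ∑ x, w x = 1) (hK : 1 ≤ K)
    (hab : a ≤ b) (hMv : 0 ≤ Mv) (hvar : ∀ u ∈ Icc a b, lawVariance (stFinTilt w X u) X ≤ Mv)
    (hKM : (b - a) * sqrt Mv ≤ K)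
    (hM : ∀ k, IsRowStochastic (M k))
    (hMrev : ∀ k : Fin (K + 1), DetailedBalance (stFinTilt w X (a + k * ((b - a) / K))) (M k))
    (hMirr : ∀ k, IsIrreducible (M k)) {γ : ℝ} (hγ : 0 < γ)
    (hgap : ∀ k : Fin (K + 1), ∀ h : S → ℝ,
      γ * lawVariance (stFinTilt w X (a + k * ((b - a) / K))) h
        ≤ dirichletForm (stFinTilt w X (a + k * ((b - a) / K))) (M k) h)
    {g : Fin (K + 1) × S → ℝ}
    (hg : 0 < lawVariance (stFinLaw fun k : Fin (K + 1) => stFinTilt w X (a + k * ((b - a) / K))) g) :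
    asympVar g (stFinLaw fun k : Fin (K + 1) => stFinTilt w X (a + k * ((b - a) / K)))
        (stFinSampler (1 / 2) (fun k : Fin (K + 1) => stFinTilt w X (a + k * ((b - a) / K))) M)
        / (2 * lawVariance (stFinLaw fun k : Fin (K + 1) => stFinTilt w X (a + k * ((b - a) / K))) g)
      ≤ 8 * exp 2 * (K + 1) ^ 2 / min 1 γ - 1 / 2 :=
  stFinWindow_tauInt_le hw hw1 hK hab hMv
    (fun u hu => by rw [variance_tilted_finLawMeasure (fun x => (hw x).le)]; exact hvar u hu)
    hKM hM hMrev hMirr hγ hgap hg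

end Window

end Summit.Ventures.LatticeQCDFlow.Scaling

end
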